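import Literature.NumberTheory.Automorphic.UnitaryGroupIsotropicLineElements
import Literature.NumberTheory.Automorphic.UnitaryGroupLocalReflections
import Literature.NumberTheory.Automorphic.Liu2021.LemD1DataOfPlace
import HarnessLib

/-!
# The root subgroup of an isotropic line of `U(J)(F_v)` through `ι_v : U(J)(F_v) → Sp(𝕎_v)`:
# `ι(n_{bδ}) = 1 + b · 𝔫`, `𝔫² = 0`, `⟨x, 𝔫 x⟩ = Nm_{E_v/F_v} h(r, x)`

Topic `NumberTheory/Automorphic`; namespace `Literature.NumberTheory.Automorphic.UnitaryGroup` (continues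
`UnitaryGroupIsotropicLineElements` — root elements `lineRoot σ H x w z`, `lineRootGL`, `lineRootGL_mem` — and
`UnitaryGroupLocalReflections` — `iota_localPiEquiv_symm_reIm`, `alt_polar_localPairing_reIm`, `conjLocal_mul_self`).
KERNEL ONLY: definitions with bodies and theorems; no named fact, no `sorry`.

**Setting.** §1 is over a commutative ring `S` with an endomorphism `σ`, a form matrix `H` and the pairing
`h = hermForm σ H` (`h(x, y) = (σ x)ᵀ H y`).  §2 is at a finite place `v` of the quadratic extension `E/F` of number fields:
`K = F_v`, `S = E_v = E ⊗_F F_v` (`UnitaryGroup.LocalRing E v`) with `φ = toLocalRing E v`, coordinates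
`reIm : E_vᴺ ≃ F_vᴺ × F_vᴺ` of `quadraticLocalEquiv` (`z = φ(re z) + φ(im z) δ`, `δ² = d`), `σ = c ⊗ 1` (`conjLocal`), the Gram
matrix `J_v = (J ⊗ 1)_v` of `UnitaryGroup.«local» E c N J v` (`(adelicForm E N J).map (adeleToLocal E v)`) and, for
`J = T ⊗ 1`, the embedding `ι_v = iota F E c N hcδ hδ hd T hT hJ v : U(J)(F_v) → Sp(𝕎_v)` (factor form `localPi`),
`𝕎_v = F_vᴺ × F_vᴺ` with the commutator form `A = alt (polar β_T)`, `A(reIm y, reIm x) = im h(y, x)`.  The public apply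
lemma for the IRREDUCIBLE `iota` is the tree's `iota_localPiEquiv_symm_reIm` (and `MoeglinVignerasWaldspurger1987.iota_apply_reIm`);
nothing of `localPiToSymplectic` is unfolded here.

* §1 (generic) the NILPOTENT MATRIX `rootNilMatrix σ H r δ = r ⊗ (δ · h(r, ·))` (`v ↦ (δ h(r,v)) • r`):
  `lineRoot σ H r 0 (b δ) = 1 + b • rootNilMatrix` (the transvection `n_{bδ}` of the line `S r`,
  [Dieudonne1971GroupesClassiques, Chap. II §5]), `rootNilMatrix² = 0` for `r` isotropic, the composition law
  `T_u(0,a) T_u(0,b) = T_u(0, a + b + a b h(u,u))` along any vector, and the conjugation of root elements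
  `g · T_r(0, z) · g⁻¹ = T_{g r}(0, z)` for `g ∈ U(σ, H)`.
* §2 (at `v`) the root elements `localRootElt … hr b = n_{bδ}(r) ∈ U(J)(F_v)` of an isotropic `r ∈ E_vᴺ` (`b ∈ F_v`; B-p19's
  `lineRootGL` moved to `localPi`), additive in `b`; the `F_v`-linear nilpotent
  `localRootNil … r = Res(r ⊗ δ h(r, ·)) ∈ End_{F_v}(F_vᴺ × F_vᴺ)`; and THE TWO IDENTITIES of piece P2 of the cell's line
  `b4-rank-one-theta-lines-disjoint`: **`ι_v(n_{bδ}(r)) x = x + b • 𝔫 x`** (`iota_localRootElt_apply`) and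
  **`A(x, 𝔫 x) = Nm_{E_v/F_v} h(r, u)`** for `x = reIm u` (`alt_polar_localRootNil_self`: `= (re α)² − d (im α)²`, `α = h(r,u)`;
  `toLocalRing_alt_polar_localRootNil_self`: `φ(A(x, 𝔫 x)) = σ(α) α`); with `𝔫 ∘ 𝔫 = 0`, `𝔫 (reIm u) = reIm ((δ α) • r)`
  (`im 𝔫 ⊆ Res(E_v r)`, all of it along a partner `r'` with `h(r, r') = 1`), `A(𝔫 x, 𝔫 y) = 0` (the image is isotropic) and
  `A(x, 𝔫 y) = A(y, 𝔫 x)` (the form `⟨x, 𝔫 y⟩` is symmetric).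

Sequel: `UnitaryGroupHyperbolicSwap.lean` (quasi-reflections, the swap `r ↔ r'`, existence of isotropic vectors for
`N ≥ 3` and of hyperbolic partners at non-split places).  Written for the cell `hodgecm-mathlib` (fan B; row IV-4(c1)
`rankOne_theta_lines_disjoint`, support form of the compact doubling, piece P2 «root data through ι»).  Nothing about
theta lifts is asserted here.

## References
* [Dieudonne1971GroupesClassiques] J. Dieudonné, *La géométrie des groupes classiques*, 3e éd. (1971), Chap. II §§4–5.
* [MoeglinVignerasWaldspurger1987] C. Mœglin, M.-F. Vignéras, J.-L. Waldspurger, LNM 1291 (1987), Chap. 1 I.11, I.17,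
  Chap. 3 §IV.2.
-/

set_option autoImplicit false

noncomputable section

open Matrix NumberField IsDedekindDomain
open Literature.RepresentationTheory.HeisenbergGroup
open Literature.NumberTheory.GelbartRogawski1991.UnitaryDualPair.LocalSplitting (iota localPairing)

namespace Literature.NumberTheory.Automorphic.UnitaryGroup

/-! ## §1 Generic: the nilpotent matrix of an isotropic vector, composition and conjugation of root elements -/

section Generic

variable {S : Type*} [CommRing S] (σ : S →+* S) {n : Type*} [Fintype n] [DecidableEq n] (H : Matrix n n S)

omit [DecidableEq n] in
/-- `(u ⊗ w) v = ⟨w, v⟩ • u` over a commutative ring. [folklore] -/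
private theorem vecMulVec_mulVec_eq_smul (u w v : n → S) : vecMulVec u w *ᵥ v = (w ⬝ᵥ v) • u := by
  rw [Matrix.vecMulVec_mulVec]
  funext i
  simp [mul_comm]

omit [DecidableEq n] in
/-- `h(0, ·)` has row `0` (`T_x(0, z)` has no Siegel part). [cite: Dieudonne1971GroupesClassiques, Chap. II §5] -/
theorem hermRow_zero : hermRow σ H (0 : n → S) = 0 := by
  have h0 : (⇑σ ∘ (0 : n → S)) = 0 := funext fun _ => map_zero σ
  rw [hermRow, h0, Matrix.zero_vecMul]

/-- **the nilpotent matrix `𝔫̃ = r ⊗ (δ · h(r, ·))`** (`v ↦ (δ h(r, v)) • r`) of a vector `r` and a scalar `δ`: the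
direction of the one-parameter group of transvections `n_{bδ} = 1 + b 𝔫̃` of the line `S r`.
[cite: Dieudonne1971GroupesClassiques, Chap. II §5] -/
def rootNilMatrix (r : n → S) (δ : S) : Matrix n n S := vecMulVec r (δ • hermRow σ H r)

omit [DecidableEq n] in
/-- **action**: `𝔫̃ v = (δ h(r, v)) • r`. [cite: Dieudonne1971GroupesClassiques, Chap. II §5] -/
theorem rootNilMatrix_mulVec (r : n → S) (δ : S) (v : n → S) :
    rootNilMatrix σ H r δ *ᵥ v = (δ * hermForm σ H r v) • r := by
  rw [rootNilMatrix, vecMulVec_mulVec_eq_smul, smul_dotProduct, smul_eq_mul, hermRow_dotProduct]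

/-- the transvection with parameter `z = a` along `u` is `1 + a • u ⊗ h(u, ·)`. [cite: Dieudonne1971GroupesClassiques, Chap. II §4] -/
theorem lineRoot_zero_left (u : n → S) (a : S) : lineRoot σ H u 0 a = 1 + a • vecMulVec u (hermRow σ H u) := by
  rw [lineRoot, Matrix.zero_vecMulVec, add_zero, hermRow_zero, sub_zero, Matrix.vecMulVec_smul]

/-- **`n_{bδ}(r) = 1 + b • 𝔫̃`**: the transvection `T_r(0, b δ)` of the line is `1 + b · rootNilMatrix σ H r δ`.
[cite: Dieudonne1971GroupesClassiques, Chap. II §5] -/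
theorem lineRoot_zero_mul_eq (r : n → S) (b δ : S) :
    lineRoot σ H r 0 (b * δ) = 1 + b • rootNilMatrix σ H r δ := by
  rw [lineRoot_zero_left, rootNilMatrix, ← Matrix.vecMulVec_smul, ← Matrix.vecMulVec_smul, smul_smul]

omit [DecidableEq n] in
/-- **`𝔫̃² = 0`** for `r` isotropic (`h(r, r) = 0`). [cite: Dieudonne1971GroupesClassiques, Chap. II §5] -/
theorem rootNilMatrix_mul_self {r : n → S} (δ : S) (hr : hermForm σ H r r = 0) :
    rootNilMatrix σ H r δ * rootNilMatrix σ H r δ = 0 := by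
  rw [rootNilMatrix, Matrix.vecMulVec_mul_vecMulVec, smul_dotProduct, hermRow_dotProduct, hr, smul_zero, zero_smul,
    Matrix.vecMulVec_zero]

/-- the row of `h(g r, ·)` for `g ∈ U(σ, H)`: `h(g r, ·) = h(r, g⁻¹ ·)`, i.e. `hermRow (g r) = hermRow r · g⁻¹`.
[cite: Dieudonne1971GroupesClassiques, Chap. II §5] -/
theorem hermRow_mulVec_eq_vecMul_inv (g : GL n S) (hg : g ∈ unitaryGroupOfForm σ H) (r : n → S) :
    hermRow σ H ((g : Matrix n n S) *ᵥ r) = hermRow σ H r ᵥ* ((g⁻¹ : GL n S) : Matrix n n S) := by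
  rw [mem_unitaryGroupOfForm_iff] at hg
  have h1 : (⇑σ ∘ ((g : Matrix n n S) *ᵥ r)) = (g : Matrix n n S).map σ *ᵥ (⇑σ ∘ r) :=
    funext fun i => RingHom.map_mulVec σ (g : Matrix n n S) r i
  have h2 : ((g : Matrix n n S).map σ)ᵀ * H = H * ((g⁻¹ : GL n S) : Matrix n n S) := by
    calc ((g : Matrix n n S).map σ)ᵀ * H
        = ((g : Matrix n n S).map σ)ᵀ * H * ((g : Matrix n n S) * ((g⁻¹ : GL n S) : Matrix n n S)) := by
          rw [← Units.val_mul, mul_inv_cancel, Units.val_one, Matrix.mul_one]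
      _ = H * ((g⁻¹ : GL n S) : Matrix n n S) := by rw [← Matrix.mul_assoc, hg]
  rw [hermRow, hermRow, h1, ← Matrix.vecMul_transpose, Matrix.vecMul_vecMul, h2, ← Matrix.vecMul_vecMul]

/-- **conjugation of root elements**: `g · T_r(0, z) · g⁻¹ = T_{g r}(0, z)` for `g ∈ U(σ, H)` — a unitary `g` moves the
transvections of the line `S r` to those of `S (g r)`. [cite: Dieudonne1971GroupesClassiques, Chap. II §5] -/
theorem conj_lineRoot_zero (g : GL n S) (hg : g ∈ unitaryGroupOfForm σ H) (r : n → S) (z : S) :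
    (g : Matrix n n S) * lineRoot σ H r 0 z * ((g⁻¹ : GL n S) : Matrix n n S) =
      lineRoot σ H ((g : Matrix n n S) *ᵥ r) 0 z := by
  rw [lineRoot_zero_left, lineRoot_zero_left, Matrix.mul_add, Matrix.mul_one, Matrix.add_mul, ← Units.val_mul,
    mul_inv_cancel, Units.val_one, Matrix.mul_smul, Matrix.smul_mul, Matrix.mul_vecMulVec, Matrix.vecMulVec_mul,
    ← hermRow_mulVec_eq_vecMul_inv σ H g hg r]

/-- composition of transvections along one vector: `T_u(0, a) T_u(0, b) = T_u(0, a + b + a b h(u,u))`.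
[cite: Dieudonne1971GroupesClassiques, Chap. II §4] -/
theorem lineRoot_zero_mul_lineRoot_zero (u : n → S) (a b : S) :
    lineRoot σ H u 0 a * lineRoot σ H u 0 b = lineRoot σ H u 0 (a + b + a * b * hermForm σ H u u) := by
  rw [lineRoot_zero_left, lineRoot_zero_left, lineRoot_zero_left, reflMatrix_mul_reflMatrix, hermRow_dotProduct]

end Generic

/-! ## §2 At a finite place `v`: root elements of `U(J)(F_v)`, `ι_v(n_{bδ}) = 1 + b · 𝔫`, and `⟨x, 𝔫 x⟩ = Nm h(r, u)` -/

section Local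

variable {F : Type} [Field F] [NumberField F] (E : Type) [Field E] [NumberField E] [Algebra F E]
  [Algebra.IsQuadraticExtension F E] (c : E ≃ₐ[F] E) (N : ℕ) (J : Matrix (Fin N) (Fin N) E)
  (v : HeightOneSpectrum (𝓞 F)) {δ : E} (hcδ : c δ = -δ) (hδ : δ ≠ 0)

include hcδ in
omit [Algebra.IsQuadraticExtension F E] in
/-- `z = φ(b) · (δ ⊗ 1)` is trace-zero: `z + σ z = 0` (`σ = c ⊗ 1` fixes `φ(F_v)` and negates `δ ⊗ 1`).
[cite: CasselsFrohlichANT1967, Ch. II §10] -/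
theorem toLocalRing_mul_delta_add_conjLocal (b : v.adicCompletion F) :
    toLocalRing E v b * algebraMap E (LocalRing E v) δ +
        conjLocal E c v (toLocalRing E v b * algebraMap E (LocalRing E v) δ) = 0 := by
  rw [map_mul, conjLocal_toLocalRing, conjLocal_algebraMap, hcδ, map_neg, mul_neg, add_neg_cancel]

/-- **the root element `n_{bδ}(r) ∈ U(J)(F_v)`** (factor form `localPi`) of an isotropic vector `r ∈ E_vᴺ` and `b ∈ F_v`:
the transvection `v ↦ v + (φ(b) δ h(r, v)) • r` of the line `E_v r` (B-p19's `lineRootGL` at `w = 0`, `z = φ(b) δ`, moved to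
`localPi` by `localPiEquiv`). [cite: Dieudonne1971GroupesClassiques, Chap. II §5] -/
def localRootElt (hJh : (J.map c)ᵀ = J) {r : Fin N → LocalRing E v}
    (hr : hermForm (conjLocal E c v) ((adelicForm E N J).map (adeleToLocal E v)) r r = 0) (b : v.adicCompletion F) :
    localPi E c N J v :=
  (localPiEquiv E c N J v).symm
    ⟨lineRootGL (conjLocal E c v) ((adelicForm E N J).map (adeleToLocal E v))
        (toLocalRing E v b * algebraMap E (LocalRing E v) δ) hr
        (hermForm_zero_left _ _ r) (hermForm_zero_right _ _ r),
      lineRootGL_mem _ _ (Liu2021.LemD1OfPlace.conjLocal_conjLocal_apply E v c hcδ hδ)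
        (Liu2021.LemD1OfPlace.localGram_hermitian E v c N J hJh) hr _ _
        (by rw [hermForm_zero_left, add_zero]; exact toLocalRing_mul_delta_add_conjLocal E c v hcδ b)⟩

/-- **the matrix of `n_{bδ}(r)`** over `E_v`: `lineRoot σ J_v r 0 (φ(b) δ)`. [cite: Dieudonne1971GroupesClassiques, Chap. II §5] -/
theorem coe_localPiEquiv_localRootElt (hJh : (J.map c)ᵀ = J) {r : Fin N → LocalRing E v}
    (hr : hermForm (conjLocal E c v) ((adelicForm E N J).map (adeleToLocal E v)) r r = 0) (b : v.adicCompletion F) :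
    ((localPiEquiv E c N J v (localRootElt E c N J v hcδ hδ hJh hr b) : «local» E c N J v) :
        GL (Fin N) (LocalRing E v)).val =
      lineRoot (conjLocal E c v) ((adelicForm E N J).map (adeleToLocal E v)) r 0
        (toLocalRing E v b * algebraMap E (LocalRing E v) δ) := by
  rw [localRootElt, ContinuousMulEquiv.apply_symm_apply]
  rfl

/-- **`b ↦ n_{bδ}(r)` is additive**: `n_{(b+b')δ} = n_{bδ} n_{b'δ}` (the Heisenberg law `T(0,z) T(0,z') = T(0, z + z')` on the
centre of `N_r`). [cite: Dieudonne1971GroupesClassiques, Chap. II §5] -/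
theorem localRootElt_add (hJh : (J.map c)ᵀ = J) {r : Fin N → LocalRing E v}
    (hr : hermForm (conjLocal E c v) ((adelicForm E N J).map (adeleToLocal E v)) r r = 0) (b b' : v.adicCompletion F) :
    localRootElt E c N J v hcδ hδ hJh hr (b + b') =
      localRootElt E c N J v hcδ hδ hJh hr b * localRootElt E c N J v hcδ hδ hJh hr b' := by
  apply (localPiEquiv E c N J v).injective
  rw [map_mul]
  apply Subtype.ext
  apply Units.ext
  rw [Subgroup.coe_mul, Units.val_mul, coe_localPiEquiv_localRootElt, coe_localPiEquiv_localRootElt,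
    coe_localPiEquiv_localRootElt, lineRoot_mul_lineRoot _ _ _ _ hr (hermForm_zero_left _ _ r) (hermForm_zero_right _ _ r),
    add_zero, hermForm_zero_left, sub_zero, map_add, add_mul]

/-- `n_{0}(r) = 1`. [cite: Dieudonne1971GroupesClassiques, Chap. II §5] -/
theorem localRootElt_zero (hJh : (J.map c)ᵀ = J) {r : Fin N → LocalRing E v}
    (hr : hermForm (conjLocal E c v) ((adelicForm E N J).map (adeleToLocal E v)) r r = 0) :
    localRootElt E c N J v hcδ hδ hJh hr 0 = 1 := by
  apply (localPiEquiv E c N J v).injective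
  rw [map_one]
  apply Subtype.ext
  apply Units.ext
  rw [coe_localPiEquiv_localRootElt, map_zero, zero_mul, lineRoot_zero_zero]
  rfl

variable {d : F} (hd : δ * δ = algebraMap F E d)

/-- **the nilpotent `𝔫 = Res_{E_v/F_v}(r ⊗ δ h(r, ·)) ∈ End_{F_v}(F_vᴺ × F_vᴺ)`**: the `E_v`-linear map `u ↦ (δ h(r, u)) • r`
read in the coordinates `reIm` of `𝕎_v` (`resEnd` of `rootNilMatrix`). [cite: MoeglinVignerasWaldspurger1987, Ch. 1 I.17] -/
def localRootNil (r : Fin N → LocalRing E v) :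
    Module.End (v.adicCompletion F) ((Fin N → v.adicCompletion F) × (Fin N → v.adicCompletion F)) :=
  (isQuadraticCoordinates_local E v c hcδ hδ hd).resEnd (Fin N)
    (rootNilMatrix (conjLocal E c v) ((adelicForm E N J).map (adeleToLocal E v)) r (algebraMap E (LocalRing E v) δ))

/-- **`𝔫 (reIm u) = reIm ((δ h(r, u)) • r)`** — in particular `im 𝔫 ⊆ Res(E_v r)`. [cite: MoeglinVignerasWaldspurger1987, Ch. 1 I.17] -/
theorem localRootNil_reIm (r u : Fin N → LocalRing E v) :
    localRootNil E c N J v hcδ hδ hd r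
        (QuadraticCoordinates.reIm (quadraticLocalEquiv E v c hcδ hδ).toLinearEquiv.toAddEquiv (Fin N) u) =
      QuadraticCoordinates.reIm (quadraticLocalEquiv E v c hcδ hδ).toLinearEquiv.toAddEquiv (Fin N)
        ((algebraMap E (LocalRing E v) δ *
            hermForm (conjLocal E c v) ((adelicForm E N J).map (adeleToLocal E v)) r u) • r) := by
  rw [localRootNil, IsQuadraticCoordinates.resEnd_reIm, rootNilMatrix_mulVec]

/-- along a vector `r'` with `h(r, r') = 1`: `𝔫 (reIm (t • r')) = reIm ((δ t) • r)` — so `im 𝔫 = Res(E_v r)` as soon as `r`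
has a partner. [cite: MoeglinVignerasWaldspurger1987, Ch. 1 I.17] -/
theorem localRootNil_reIm_smul_partner {r r' : Fin N → LocalRing E v}
    (hrr' : hermForm (conjLocal E c v) ((adelicForm E N J).map (adeleToLocal E v)) r r' = 1) (t : LocalRing E v) :
    localRootNil E c N J v hcδ hδ hd r
        (QuadraticCoordinates.reIm (quadraticLocalEquiv E v c hcδ hδ).toLinearEquiv.toAddEquiv (Fin N) (t • r')) =
      QuadraticCoordinates.reIm (quadraticLocalEquiv E v c hcδ hδ).toLinearEquiv.toAddEquiv (Fin N)
        ((algebraMap E (LocalRing E v) δ * t) • r) := by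
  rw [localRootNil_reIm, hermForm_smul_right, hrr', mul_one]

/-- **`𝔫 ∘ 𝔫 = 0`** for `r` isotropic. [cite: Dieudonne1971GroupesClassiques, Chap. II §5] -/
theorem localRootNil_comp_self {r : Fin N → LocalRing E v}
    (hr : hermForm (conjLocal E c v) ((adelicForm E N J).map (adeleToLocal E v)) r r = 0) :
    localRootNil E c N J v hcδ hδ hd r ∘ₗ localRootNil E c N J v hcδ hδ hd r = 0 := by
  rw [localRootNil, ← Module.End.mul_eq_comp, ← map_mul, rootNilMatrix_mul_self _ _ _ hr]
  refine LinearMap.ext fun p => ?_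
  obtain ⟨u, rfl⟩ := (QuadraticCoordinates.reIm (quadraticLocalEquiv E v c hcδ hδ).toLinearEquiv.toAddEquiv (Fin N)).surjective p
  rw [IsQuadraticCoordinates.resEnd_reIm, Matrix.zero_mulVec, map_zero, LinearMap.zero_apply]

include hd in
/-- `reIm` is `F_v`-linear for the scalars `φ(F_v) ⊂ E_v`: `reIm (φ(t) • w) = t • reIm w` (`E ⊗_F F_v = F_v ⊕ F_v δ` as an
`F_v`-module). [cite: CasselsFrohlichANT1967, Ch. II §10] -/
theorem reIm_toLocalRing_smul (t : v.adicCompletion F) (w : Fin N → LocalRing E v) :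
    QuadraticCoordinates.reIm (quadraticLocalEquiv E v c hcδ hδ).toLinearEquiv.toAddEquiv (Fin N) (toLocalRing E v t • w) =
      t • QuadraticCoordinates.reIm (quadraticLocalEquiv E v c hcδ hδ).toLinearEquiv.toAddEquiv (Fin N) w := by
  have hq := isQuadraticCoordinates_local E v c hcδ hδ hd
  refine Prod.ext (funext fun i => ?_) (funext fun i => ?_)
  · simp only [QuadraticCoordinates.reIm_apply_fst, Pi.smul_apply, smul_eq_mul, Prod.smul_fst, hq.re_map_mul]
  · simp only [QuadraticCoordinates.reIm_apply_snd, Pi.smul_apply, smul_eq_mul, Prod.smul_snd, hq.im_map_mul]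

/-- `ι_v(n_{bδ}(r)) (reIm u) = reIm (n_{bδ}(r) u)` (the tree's `iota_localPiEquiv_symm_reIm`).
[cite: MoeglinVignerasWaldspurger1987, Ch. 1 I.17] -/
theorem iota_localRootElt_reIm (T : Matrix (Fin N) (Fin N) F) (hT : T.IsSymm)
    (hJ : J = T.map (algebraMap F E)) (hJh : (J.map c)ᵀ = J) {r : Fin N → LocalRing E v}
    (hr : hermForm (conjLocal E c v) ((adelicForm E N J).map (adeleToLocal E v)) r r = 0) (b : v.adicCompletion F)
    (u : Fin N → LocalRing E v) :
    (iota F E c N hcδ hδ hd T hT hJ v (localRootElt E c N J v hcδ hδ hJh hr b)).1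
        (QuadraticCoordinates.reIm (quadraticLocalEquiv E v c hcδ hδ).toLinearEquiv.toAddEquiv (Fin N) u) =
      QuadraticCoordinates.reIm (quadraticLocalEquiv E v c hcδ hδ).toLinearEquiv.toAddEquiv (Fin N)
        (lineRoot (conjLocal E c v) ((adelicForm E N J).map (adeleToLocal E v)) r 0
            (toLocalRing E v b * algebraMap E (LocalRing E v) δ) *ᵥ u) := by
  rw [localRootElt, iota_localPiEquiv_symm_reIm]
  rfl

/-- **`ι_v(n_{bδ}(r)) = 1 + b · 𝔫`** (piece P2, first identity): the symplectic image of the root element is the unipotent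
`x ↦ x + b • 𝔫 x` of `𝕎_v = F_vᴺ × F_vᴺ`. [cite: MoeglinVignerasWaldspurger1987, Ch. 1 I.17; Dieudonne1971GroupesClassiques, Chap. II §5] -/
theorem iota_localRootElt_apply (T : Matrix (Fin N) (Fin N) F) (hT : T.IsSymm)
    (hJ : J = T.map (algebraMap F E)) (hJh : (J.map c)ᵀ = J) {r : Fin N → LocalRing E v}
    (hr : hermForm (conjLocal E c v) ((adelicForm E N J).map (adeleToLocal E v)) r r = 0) (b : v.adicCompletion F)
    (p : (Fin N → v.adicCompletion F) × (Fin N → v.adicCompletion F)) :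
    (iota F E c N hcδ hδ hd T hT hJ v (localRootElt E c N J v hcδ hδ hJh hr b)).1 p =
      p + b • localRootNil E c N J v hcδ hδ hd r p := by
  obtain ⟨u, rfl⟩ := (QuadraticCoordinates.reIm (quadraticLocalEquiv E v c hcδ hδ).toLinearEquiv.toAddEquiv (Fin N)).surjective p
  rw [iota_localRootElt_reIm, lineRoot_zero_mul_eq, Matrix.add_mulVec, Matrix.one_mulVec, Matrix.smul_mulVec, map_add,
    reIm_toLocalRing_smul E c N v hcδ hδ hd, localRootNil, IsQuadraticCoordinates.resEnd_reIm]

/-- **`A(reIm u, 𝔫 (reIm u)) = Nm_{E_v/F_v} h(r, u)`** (piece P2, second identity), `A = alt (polar β_T)` the commutator form of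
`𝕎_v` and `Nm` read in coordinates: `(re α)² − d (im α)²`, `α = h(r, u)` — the quadratic form `x ↦ ⟨x, 𝔫 x⟩` is the NORM FORM
of `E_v/F_v` transported along `h(r, ·)`. [cite: MoeglinVignerasWaldspurger1987, Ch. 1 I.17, Chap. 1 I.11 (4 b)] -/
theorem alt_polar_localRootNil_self (T : Matrix (Fin N) (Fin N) F) (hT : T.IsSymm)
    (hJ : J = T.map (algebraMap F E)) (hJh : (J.map c)ᵀ = J) (r u : Fin N → LocalRing E v) :
    alt (polar (localPairing F N T v))
        (QuadraticCoordinates.reIm (quadraticLocalEquiv E v c hcδ hδ).toLinearEquiv.toAddEquiv (Fin N) u)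
        (localRootNil E c N J v hcδ hδ hd r
          (QuadraticCoordinates.reIm (quadraticLocalEquiv E v c hcδ hδ).toLinearEquiv.toAddEquiv (Fin N) u)) =
      QuadraticCoordinates.re (quadraticLocalEquiv E v c hcδ hδ).toLinearEquiv.toAddEquiv
          (hermForm (conjLocal E c v) ((adelicForm E N J).map (adeleToLocal E v)) r u) ^ 2 -
        (d : v.adicCompletion F) *
          QuadraticCoordinates.im (quadraticLocalEquiv E v c hcδ hδ).toLinearEquiv.toAddEquiv
            (hermForm (conjLocal E c v) ((adelicForm E N J).map (adeleToLocal E v)) r u) ^ 2 := by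
  have hq := isQuadraticCoordinates_local E v c hcδ hδ hd
  have hσ := Liu2021.LemD1OfPlace.conjLocal_conjLocal_apply E v c hcδ hδ
  have hH := Liu2021.LemD1OfPlace.localGram_hermitian E v c N J hJh
  rw [localRootNil_reIm, alt_polar_localPairing_reIm E c hcδ hδ hd T hT v, ← localForm_eq_map E N v T hJ, hermForm_smul_right,
    ← conj_hermForm (conjLocal E c v) _ hσ hH r u, mul_assoc,
    mul_comm (hermForm (conjLocal E c v) _ r u) (conjLocal E c v (hermForm (conjLocal E c v) _ r u)),
    conjLocal_mul_self E c hcδ hδ hd v, mul_comm, hq.im_map_mul, hq.im_delta, mul_one]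

/-- the same read back in `E_v`: `φ(A(reIm u, 𝔫 (reIm u))) = σ(α) · α`, `α = h(r, u)`. [cite: MoeglinVignerasWaldspurger1987, Chap. 1 I.11 (4 b)] -/
theorem toLocalRing_alt_polar_localRootNil_self (T : Matrix (Fin N) (Fin N) F) (hT : T.IsSymm)
    (hJ : J = T.map (algebraMap F E)) (hJh : (J.map c)ᵀ = J) (r u : Fin N → LocalRing E v) :
    toLocalRing E v (alt (polar (localPairing F N T v))
        (QuadraticCoordinates.reIm (quadraticLocalEquiv E v c hcδ hδ).toLinearEquiv.toAddEquiv (Fin N) u)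
        (localRootNil E c N J v hcδ hδ hd r
          (QuadraticCoordinates.reIm (quadraticLocalEquiv E v c hcδ hδ).toLinearEquiv.toAddEquiv (Fin N) u))) =
      conjLocal E c v (hermForm (conjLocal E c v) ((adelicForm E N J).map (adeleToLocal E v)) r u) *
        hermForm (conjLocal E c v) ((adelicForm E N J).map (adeleToLocal E v)) r u := by
  rw [alt_polar_localRootNil_self E c N J v hcδ hδ hd T hT hJ hJh, conjLocal_mul_self E c hcδ hδ hd v]

/-- `A(x, 𝔫 x)` for a general `x ∈ 𝕎_v`: `= Nm h(r, reIm⁻¹ x)`. [cite: MoeglinVignerasWaldspurger1987, Ch. 1 I.17] -/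
theorem alt_polar_localRootNil_self' (T : Matrix (Fin N) (Fin N) F) (hT : T.IsSymm)
    (hJ : J = T.map (algebraMap F E)) (hJh : (J.map c)ᵀ = J) (r : Fin N → LocalRing E v)
    (p : (Fin N → v.adicCompletion F) × (Fin N → v.adicCompletion F)) :
    alt (polar (localPairing F N T v)) p (localRootNil E c N J v hcδ hδ hd r p) =
      QuadraticCoordinates.re (quadraticLocalEquiv E v c hcδ hδ).toLinearEquiv.toAddEquiv
          (hermForm (conjLocal E c v) ((adelicForm E N J).map (adeleToLocal E v)) r
            ((QuadraticCoordinates.reIm (quadraticLocalEquiv E v c hcδ hδ).toLinearEquiv.toAddEquiv (Fin N)).symm p)) ^ 2 -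
        (d : v.adicCompletion F) *
          QuadraticCoordinates.im (quadraticLocalEquiv E v c hcδ hδ).toLinearEquiv.toAddEquiv
            (hermForm (conjLocal E c v) ((adelicForm E N J).map (adeleToLocal E v)) r
              ((QuadraticCoordinates.reIm (quadraticLocalEquiv E v c hcδ hδ).toLinearEquiv.toAddEquiv (Fin N)).symm p)) ^ 2 := by
  obtain ⟨u, rfl⟩ := (QuadraticCoordinates.reIm (quadraticLocalEquiv E v c hcδ hδ).toLinearEquiv.toAddEquiv (Fin N)).surjective p
  rw [AddEquiv.symm_apply_apply]
  exact alt_polar_localRootNil_self E c N J v hcδ hδ hd T hT hJ hJh r u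

/-- **`im 𝔫` is isotropic**: `A(𝔫 (reIm u), 𝔫 (reIm u')) = 0` (`h(r, r) = 0`). [cite: MoeglinVignerasWaldspurger1987, Ch. 1 I.17] -/
theorem alt_polar_localRootNil_localRootNil (T : Matrix (Fin N) (Fin N) F) (hT : T.IsSymm)
    (hJ : J = T.map (algebraMap F E)) {r : Fin N → LocalRing E v}
    (hr : hermForm (conjLocal E c v) ((adelicForm E N J).map (adeleToLocal E v)) r r = 0) (u u' : Fin N → LocalRing E v) :
    alt (polar (localPairing F N T v))
        (localRootNil E c N J v hcδ hδ hd r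
          (QuadraticCoordinates.reIm (quadraticLocalEquiv E v c hcδ hδ).toLinearEquiv.toAddEquiv (Fin N) u))
        (localRootNil E c N J v hcδ hδ hd r
          (QuadraticCoordinates.reIm (quadraticLocalEquiv E v c hcδ hδ).toLinearEquiv.toAddEquiv (Fin N) u')) = 0 := by
  rw [localRootNil_reIm, localRootNil_reIm, alt_polar_localPairing_reIm E c hcδ hδ hd T hT v, ← localForm_eq_map E N v T hJ,
    hermForm_smul_left_eq, hermForm_smul_right, hr, mul_zero, mul_zero, map_zero]

/-- **`A(x, 𝔫 y)` is symmetric**: `A(reIm u, 𝔫 (reIm u')) = A(reIm u', 𝔫 (reIm u))` (`= im(δ h(r,u') σ h(r,u))`, and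
`σ(δ α' σα) = −δ α σα'`, `im ∘ σ = −im`). [cite: MoeglinVignerasWaldspurger1987, Ch. 1 I.17] -/
theorem alt_polar_localRootNil_comm (T : Matrix (Fin N) (Fin N) F) (hT : T.IsSymm)
    (hJ : J = T.map (algebraMap F E)) (hJh : (J.map c)ᵀ = J) (r u u' : Fin N → LocalRing E v) :
    alt (polar (localPairing F N T v))
        (QuadraticCoordinates.reIm (quadraticLocalEquiv E v c hcδ hδ).toLinearEquiv.toAddEquiv (Fin N) u)
        (localRootNil E c N J v hcδ hδ hd r
          (QuadraticCoordinates.reIm (quadraticLocalEquiv E v c hcδ hδ).toLinearEquiv.toAddEquiv (Fin N) u')) =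
      alt (polar (localPairing F N T v))
        (QuadraticCoordinates.reIm (quadraticLocalEquiv E v c hcδ hδ).toLinearEquiv.toAddEquiv (Fin N) u')
        (localRootNil E c N J v hcδ hδ hd r
          (QuadraticCoordinates.reIm (quadraticLocalEquiv E v c hcδ hδ).toLinearEquiv.toAddEquiv (Fin N) u)) := by
  have hσ := Liu2021.LemD1OfPlace.conjLocal_conjLocal_apply E v c hcδ hδ
  have hH := Liu2021.LemD1OfPlace.localGram_hermitian E v c N J hJh
  rw [localRootNil_reIm, localRootNil_reIm, alt_polar_localPairing_reIm E c hcδ hδ hd T hT v,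
    alt_polar_localPairing_reIm E c hcδ hδ hd T hT v, ← localForm_eq_map E N v T hJ, hermForm_smul_right, hermForm_smul_right,
    ← conj_hermForm (conjLocal E c v) _ hσ hH r u, ← conj_hermForm (conjLocal E c v) _ hσ hH r u']
  set α := hermForm (conjLocal E c v) ((adelicForm E N J).map (adeleToLocal E v)) r u
  set α' := hermForm (conjLocal E c v) ((adelicForm E N J).map (adeleToLocal E v)) r u'
  have key : algebraMap E (LocalRing E v) δ * α * conjLocal E c v α' =
      conjLocal E c v (-(algebraMap E (LocalRing E v) δ * α' * conjLocal E c v α)) := by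
    rw [map_neg, map_mul, map_mul, hσ, conjLocal_algebraMap, hcδ, map_neg]; ring
  rw [key, im_conjLocal E c hcδ hδ hd v, map_neg, neg_neg]

end Local

end Literature.NumberTheory.Automorphic.UnitaryGroup

end
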